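import Summits.CriticalPhenomena.PercolationContinuityZ3.Theorems.PercNearOneGluingNoHeavyLowerTailOneCutFiveZeroOne
import HarnessLib

/-!
# `NoHeavyLowerTail` (stmt-CriticalPhenomena-4575) — `Z(3,2)` is EQUIVALENT to its POCKET-EXCHANGE form
# ("o reaches exactly its weakest relay no more often than exactly the two others")

Support file (prover seat `prim-a5-assembly-2`, gen 2; `--supports stmt-CriticalPhenomena-4575`; memo
`run/shared/lean/prim/prim-a5/ASSEMBLY.md` §9–§10, INEQ-CLAIMS rows A5-Z32 / A5-ZSTAR / A5-Z32F).  No definitions, no named facts,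
no sorries; the hypothesis is written verbatim.

`μ = prodBernoulli w` on `Fin n`, observer `o`, three further vertices `a, b, c`, `q_v = μ(o ↔ v)`, pocket `B = C_o ∩ {a,b,c}`.
The four-point row `Z(3,2)` (assembly-1's `OneCutFive.ZeroOneThree`: `Σ_v q_v > 2 ⇒ μ{o reaches ≤ 1 of a,b,c} ≤ t` for every `t`
bounding the three cuts `μ(o ↮ v)`), which carries the glued half of the `|A| = 5` one-cut rung
(`OneCutFive.oneCut5_at_of_mem_of_zeroOneThree`), is EQUIVALENT to the exchange inequality between two ATOMS of the pocket law at
the weakest vertex: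

  (POCKET)  `o, a, b, c` distinct, `q_a + q_b + q_c > 2`, `q_a ≤ q_b`, `q_a ≤ q_c`  ⟹  `μ(B = {a}) ≤ μ(B = {b,c})`.

* `OneCutFive.zeroOneThree_of_pocketExchange` — (POCKET) for all graphs ⟹ `ZeroOneThree`: with `a` the weakest vertex of `R`,
  `{≤ 1 reached} ⊆ {B = {a}} ∪ ({≤ 1 reached} ∩ {o ↮ a})`; exchange `{B = {a}}` for `{B = {b,c}}`, which lies in `{o ↮ a}` and is
  disjoint from `{≤ 1 reached}`; total `≤ μ(o ↮ a) ≤ t`.  (If `o ∈ R` the event lies in `{o ↮ v}` for any other `v ∈ R`.)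
* `OneCutFive.pocketExchange_of_zeroOneThree` — conversely (take `R = {a,b,c}`, `t = μ(o ↮ a)`).
So provers may attack the atom inequality directly; its status is that of `Z(3,2)` (census-clean incl. n = 7 exhaustive; NO Π₄ row
certificate, ttrl cp-wf3b; tight on `b = c` glued with `q_a = q_bc`, on the ½-star, and on the interpolating family of ASSEMBLY §10).
HONEST LABEL: toward `|A| = 5` of the one-arm near-critical percolation programme (crux 4575); `Z(3,2)` is OPEN; nothing here asserts it.
-/

noncomputable section

namespace Summit.CriticalPhenomena.PercolationContinuityZ3.Theorems

open MeasureTheory Set Literature.Probability.LatticeModels Literature.Probability.Percolation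
open scoped Classical BigOperators

namespace OneCutFive

variable {n : ℕ}

/-- A three-element finset containing `a` is `{a, b, c}` for two further distinct elements. [folklore] -/
theorem exists_pair_of_card_three_mem (R : Finset (Fin n)) (a : Fin n) (hR : R.card = 3) (ha : a ∈ R) :
    ∃ b c : Fin n, b ∈ R ∧ c ∈ R ∧ a ≠ b ∧ a ≠ c ∧ b ≠ c ∧ R = {a, b, c} := by
  have h2 : (R.erase a).card = 2 := by rw [Finset.card_erase_of_mem ha, hR]
  obtain ⟨b, c, hbc, hbc'⟩ := Finset.card_eq_two.1 h2
  have hb : b ∈ R.erase a := by rw [hbc']; simp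
  have hc : c ∈ R.erase a := by rw [hbc']; simp
  refine ⟨b, c, (Finset.mem_erase.1 hb).2, (Finset.mem_erase.1 hc).2, (Finset.mem_erase.1 hb).1.symm,
    (Finset.mem_erase.1 hc).1.symm, hbc, ?_⟩
  rw [← Finset.insert_erase ha, hbc']

/-- Two distinct reached vertices of `R` make the reached count at least two. [folklore] -/
theorem two_le_card_filter (R : Finset (Fin n)) (o u v : Fin n) (hu : u ∈ R) (hv : v ∈ R) (huv : u ≠ v)
    (ω : BondConfig (Fin n)) (hou : ω ∈ openConn o u) (hov : ω ∈ openConn o v) :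
    2 ≤ (R.filter fun x => ω ∈ openConn o x).card := by
  have hsub : ({u, v} : Finset (Fin n)) ⊆ R.filter fun x => ω ∈ openConn o x := by
    intro x hx
    rcases Finset.mem_insert.1 hx with rfl | hx
    · exact Finset.mem_filter.2 ⟨hu, hou⟩
    · rw [Finset.mem_singleton.1 hx]; exact Finset.mem_filter.2 ⟨hv, hov⟩
  have h := Finset.card_le_card hsub
  rwa [Finset.card_pair huv] at h

/-- If `o` reaches at most one vertex of `R ∋ a, b, c` then either `o` reaches `a` and neither `b` nor `c`, or `o ↮ a`. [folklore] -/
theorem le_one_subset (R : Finset (Fin n)) (o a b c : Fin n) (ha : a ∈ R) (hb : b ∈ R) (hc : c ∈ R)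
    (hab : a ≠ b) (hac : a ≠ c) :
    {ω : BondConfig (Fin n) | (R.filter fun v => ω ∈ openConn o v).card ≤ 1} ⊆
      {ω : BondConfig (Fin n) | ω ∈ openConn o a ∧ ω ∉ openConn o b ∧ ω ∉ openConn o c} ∪
        ({ω : BondConfig (Fin n) | (R.filter fun v => ω ∈ openConn o v).card ≤ 1} ∩
          (openConn o a : Set (BondConfig (Fin n)))ᶜ) := by
  intro ω hω
  have hle : (R.filter fun v => ω ∈ openConn o v).card ≤ 1 := hω
  by_cases hoa : ω ∈ openConn o a
  · left
    refine ⟨hoa, fun hob => ?_, fun hoc => ?_⟩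
    · have := two_le_card_filter R o a b ha hb hab ω hoa hob; omega
    · have := two_le_card_filter R o a c ha hc hac ω hoa hoc; omega
  · right; exact ⟨hω, hoa⟩

/-- **`Z(3,2)` from the pocket exchange.**  If for every finite weighted graph and distinct `o, a, b, c` with
`μ(o↔a) + μ(o↔b) + μ(o↔c) > 2` and `μ(o↔a) ≤ μ(o↔b), μ(o↔c)` one has `μ(B = {a}) ≤ μ(B = {b,c})`, then `ZeroOneThree`.
[this work] -/
theorem zeroOneThree_of_pocketExchange
    (hP : ∀ (n : ℕ) (w : Sym2 (Fin n) → unitInterval) (o a b c : Fin n),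
      o ≠ a → o ≠ b → o ≠ c → a ≠ b → a ≠ c → b ≠ c →
      2 < (prodBernoulli w).real (openConn o a) + (prodBernoulli w).real (openConn o b) +
        (prodBernoulli w).real (openConn o c) →
      (prodBernoulli w).real (openConn o a) ≤ (prodBernoulli w).real (openConn o b) →
      (prodBernoulli w).real (openConn o a) ≤ (prodBernoulli w).real (openConn o c) →
      (prodBernoulli w).real {ω : BondConfig (Fin n) | ω ∈ openConn o a ∧ ω ∉ openConn o b ∧ ω ∉ openConn o c} ≤
        (prodBernoulli w).real {ω : BondConfig (Fin n) | ω ∉ openConn o a ∧ ω ∈ openConn o b ∧ ω ∈ openConn o c}) :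
    ZeroOneThree := by
  intro n w R o t hR hsum hcut
  set μ := prodBernoulli w with hμ
  have hmeas : ∀ s : Set (BondConfig (Fin n)), MeasurableSet s := fun _ => MeasurableSet.of_discrete
  set L : Set (BondConfig (Fin n)) := {ω | (R.filter fun v => ω ∈ openConn o v).card ≤ 1} with hL
  have hRne : R.Nonempty := Finset.card_pos.1 (by omega)
  by_cases hoR : o ∈ R
  · -- `o` reaches itself: at most one reached vertex forces `o ↮ v` for every other `v ∈ R`
    obtain ⟨b, c, hb, _, hob, _, _, _⟩ := exists_pair_of_card_three_mem R o hR hoR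
    have hsub : L ⊆ (openConn o b : Set (BondConfig (Fin n)))ᶜ := by
      intro ω hω hωb
      have hoo : ω ∈ openConn o o := (SimpleGraph.Reachable.refl o : (openGraph ω).Reachable o o)
      have := two_le_card_filter R o o b hoR hb hob ω hoo hωb
      have hle : (R.filter fun v => ω ∈ openConn o v).card ≤ 1 := hω
      omega
    exact (measureReal_mono hsub).trans (hcut b hb)
  · -- the weakest vertex `a` of `R`
    obtain ⟨a, ha, hmin⟩ := Finset.exists_min_image R (fun v => μ.real (openConn o v)) hRne
    obtain ⟨b, c, hb, hc, hab, hac, hbc, hRabc⟩ := exists_pair_of_card_three_mem R a hR ha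
    have hoa : o ≠ a := fun h => hoR (h ▸ ha)
    have hob : o ≠ b := fun h => hoR (h ▸ hb)
    have hoc : o ≠ c := fun h => hoR (h ▸ hc)
    -- the sum over `R = {a,b,c}`
    have hsum3 : 2 < μ.real (openConn o a) + μ.real (openConn o b) + μ.real (openConn o c) := by
      have h := hsum
      rw [hRabc, Finset.sum_insert (by simp [hab, hac]), Finset.sum_insert (by simp [hbc]),
        Finset.sum_singleton] at h
      linarith
    set E₁ : Set (BondConfig (Fin n)) := {ω | ω ∈ openConn o a ∧ ω ∉ openConn o b ∧ ω ∉ openConn o c} with hE₁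
    set E₃ : Set (BondConfig (Fin n)) := {ω | ω ∉ openConn o a ∧ ω ∈ openConn o b ∧ ω ∈ openConn o c} with hE₃
    have hP' : μ.real E₁ ≤ μ.real E₃ := hP n w o a b c hoa hob hoc hab hac hbc hsum3 (hmin b hb) (hmin c hc)
    -- `E₃` is disjoint from `L` and lies in `{o ↮ a}`
    have hdisj : Disjoint E₃ (L ∩ (openConn o a : Set (BondConfig (Fin n)))ᶜ) := by
      rw [Set.disjoint_left]
      rintro ω ⟨_, hωb, hωc⟩ ⟨hωL, _⟩
      have := two_le_card_filter R o b c hb hc hbc ω hωb hωc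
      have hle : (R.filter fun v => ω ∈ openConn o v).card ≤ 1 := hωL
      omega
    have hsubA : E₃ ∪ (L ∩ (openConn o a : Set (BondConfig (Fin n)))ᶜ) ⊆ (openConn o a : Set (BondConfig (Fin n)))ᶜ := by
      rintro ω (⟨hωa, _, _⟩ | ⟨_, hωa⟩)
      · exact hωa
      · exact hωa
    calc μ.real L
        ≤ μ.real (E₁ ∪ (L ∩ (openConn o a : Set (BondConfig (Fin n)))ᶜ)) :=
          measureReal_mono (le_one_subset R o a b c ha hb hc hab hac)
      _ ≤ μ.real E₁ + μ.real (L ∩ (openConn o a : Set (BondConfig (Fin n)))ᶜ) := measureReal_union_le _ _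
      _ ≤ μ.real E₃ + μ.real (L ∩ (openConn o a : Set (BondConfig (Fin n)))ᶜ) := by linarith
      _ = μ.real (E₃ ∪ (L ∩ (openConn o a : Set (BondConfig (Fin n)))ᶜ)) :=
          (measureReal_union hdisj (hmeas _)).symm
      _ ≤ μ.real (openConn o a : Set (BondConfig (Fin n)))ᶜ := measureReal_mono hsubA
      _ ≤ t := hcut a ha

/-- **Conversely, `Z(3,2)` gives the pocket exchange** (apply it to `R = {a,b,c}` with `t = μ(o ↮ a)`, the largest of the three
cuts, and cancel the common part `{≤ 1 reached} ∩ {o ↮ a} = {o ↮ a} ∖ {B = {b,c}}`); here `o` need not be distinct from `a, b, c`.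
[this work] -/
theorem pocketExchange_of_zeroOneThree (hZ : ZeroOneThree) (w : Sym2 (Fin n) → unitInterval) (o a b c : Fin n)
    (hab : a ≠ b) (hac : a ≠ c) (hbc : b ≠ c)
    (hsum : 2 < (prodBernoulli w).real (openConn o a) + (prodBernoulli w).real (openConn o b) +
      (prodBernoulli w).real (openConn o c))
    (hab' : (prodBernoulli w).real (openConn o a) ≤ (prodBernoulli w).real (openConn o b))
    (hac' : (prodBernoulli w).real (openConn o a) ≤ (prodBernoulli w).real (openConn o c)) :
    (prodBernoulli w).real {ω : BondConfig (Fin n) | ω ∈ openConn o a ∧ ω ∉ openConn o b ∧ ω ∉ openConn o c} ≤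
      (prodBernoulli w).real {ω : BondConfig (Fin n) | ω ∉ openConn o a ∧ ω ∈ openConn o b ∧ ω ∈ openConn o c} := by
  set μ := prodBernoulli w with hμ
  have hmeas : ∀ s : Set (BondConfig (Fin n)), MeasurableSet s := fun _ => MeasurableSet.of_discrete
  set R : Finset (Fin n) := {a, b, c} with hRdef
  have ha : a ∈ R := by simp [hRdef]
  have hb : b ∈ R := by simp [hRdef]
  have hc : c ∈ R := by simp [hRdef]
  have hR : R.card = 3 := by
    rw [hRdef, Finset.card_insert_of_notMem (by simp [hab, hac]), Finset.card_pair hbc]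
  have hsumR : 2 < ∑ v ∈ R, μ.real (openConn o v) := by
    rw [hRdef, Finset.sum_insert (by simp [hab, hac]), Finset.sum_insert (by simp [hbc]), Finset.sum_singleton]
    linarith
  -- cuts: `μ(o ↮ v) ≤ μ(o ↮ a)` for `v ∈ R`
  have hcompl : ∀ u : Fin n, μ.real (openConn o u : Set (BondConfig (Fin n)))ᶜ = 1 - μ.real (openConn o u) :=
    fun u => probReal_compl_eq_one_sub (hmeas _)
  have hcut : ∀ v ∈ R, μ.real (openConn o v : Set (BondConfig (Fin n)))ᶜ ≤
      μ.real (openConn o a : Set (BondConfig (Fin n)))ᶜ := by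
    intro v hv
    rw [hcompl, hcompl]
    rw [hRdef] at hv
    rcases Finset.mem_insert.1 hv with rfl | hv
    · exact le_rfl
    rcases Finset.mem_insert.1 hv with rfl | hv
    · linarith
    · rw [Finset.mem_singleton.1 hv]; linarith
  have hZ' := hZ n w R o _ hR hsumR hcut
  set L : Set (BondConfig (Fin n)) := {ω | (R.filter fun v => ω ∈ openConn o v).card ≤ 1} with hL
  set E₁ : Set (BondConfig (Fin n)) := {ω | ω ∈ openConn o a ∧ ω ∉ openConn o b ∧ ω ∉ openConn o c} with hE₁
  set E₃ : Set (BondConfig (Fin n)) := {ω | ω ∉ openConn o a ∧ ω ∈ openConn o b ∧ ω ∈ openConn o c} with hE₃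
  set M : Set (BondConfig (Fin n)) := L ∩ (openConn o a : Set (BondConfig (Fin n)))ᶜ with hM
  -- `L ⊇ E₁ ⊔ M` (in fact `=`), `{o ↮ a} = E₃ ⊔ M`
  have hE₁L : E₁ ⊆ L := by
    rintro ω ⟨hωa, hωb, hωc⟩
    show (R.filter fun v => ω ∈ openConn o v).card ≤ 1
    have hsub : (R.filter fun v => ω ∈ openConn o v) ⊆ {a} := by
      intro x hx
      obtain ⟨hxR, hox⟩ := Finset.mem_filter.1 hx
      rw [hRdef] at hxR
      rw [Finset.mem_singleton]
      rcases Finset.mem_insert.1 hxR with rfl | hxR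
      · rfl
      rcases Finset.mem_insert.1 hxR with rfl | hxR
      · exact absurd hox hωb
      · rw [Finset.mem_singleton.1 hxR] at hox; exact absurd hox hωc
    exact (Finset.card_le_card hsub).trans (by simp)
  have hdisj1 : Disjoint E₁ M := by
    rw [Set.disjoint_left]
    rintro ω ⟨hωa, _, _⟩ ⟨_, hωa'⟩
    exact hωa' hωa
  have hLge : μ.real E₁ + μ.real M ≤ μ.real L := by
    rw [← measureReal_union hdisj1 (hmeas _)]
    exact measureReal_mono (Set.union_subset hE₁L Set.inter_subset_left)
  have hdisj3 : Disjoint E₃ M := by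
    rw [Set.disjoint_left]
    rintro ω ⟨_, hωb, hωc⟩ ⟨hωL, _⟩
    have := two_le_card_filter R o b c hb hc hbc ω hωb hωc
    have hle : (R.filter fun v => ω ∈ openConn o v).card ≤ 1 := hωL
    omega
  have hAc : (openConn o a : Set (BondConfig (Fin n)))ᶜ ⊆ E₃ ∪ M := by
    intro ω hωa
    by_cases hbc2 : ω ∈ openConn o b ∧ ω ∈ openConn o c
    · left; exact ⟨hωa, hbc2.1, hbc2.2⟩
    · right
      refine ⟨?_, hωa⟩
      show (R.filter fun v => ω ∈ openConn o v).card ≤ 1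
      -- the reached vertices of `R` lie in `{b}` or in `{c}`
      rcases not_and_or.1 hbc2 with hωb | hωc
      · have hsub : (R.filter fun v => ω ∈ openConn o v) ⊆ {c} := by
          intro x hx
          obtain ⟨hxR, hox⟩ := Finset.mem_filter.1 hx
          rw [hRdef] at hxR
          rw [Finset.mem_singleton]
          rcases Finset.mem_insert.1 hxR with rfl | hxR
          · exact absurd hox hωa
          rcases Finset.mem_insert.1 hxR with rfl | hxR
          · exact absurd hox hωb
          · exact Finset.mem_singleton.1 hxR
        exact (Finset.card_le_card hsub).trans (by simp)
      · have hsub : (R.filter fun v => ω ∈ openConn o v) ⊆ {b} := by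
          intro x hx
          obtain ⟨hxR, hox⟩ := Finset.mem_filter.1 hx
          rw [hRdef] at hxR
          rw [Finset.mem_singleton]
          rcases Finset.mem_insert.1 hxR with rfl | hxR
          · exact absurd hox hωa
          rcases Finset.mem_insert.1 hxR with rfl | hxR
          · rfl
          · rw [Finset.mem_singleton.1 hxR] at hox; exact absurd hox hωc
        exact (Finset.card_le_card hsub).trans (by simp)
  have hAle : μ.real (openConn o a : Set (BondConfig (Fin n)))ᶜ ≤ μ.real E₃ + μ.real M :=
    (measureReal_mono hAc).trans (measureReal_union_le _ _)
  linarith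

end OneCutFive

end Summit.CriticalPhenomena.PercolationContinuityZ3.Theorems

end
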